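import Summits.CriticalPhenomena.Ising3DConformalLimit.Theorems.SynchronousCouplingRotationJoiningTiltedTransferTools
import HarnessLib

/-!
# Route `SynchronousCoupling`, crux `RotationJoining` (stmt-CriticalPhenomena-18763), line `SketchIdeator2`
(reshape 2): tools for `stub_tiltedTransfer` — the lattice form of the tilted defect bound

Second tools file of the stub `stub_tiltedTransfer` (`TiltedTransfer`: dilation joinings for TILTED cells from those
for axis cells), on top of `…TiltedTransferTools` (squared `L²` bookkeeping, second moments of block sums).

* `defect_of_decomposition`: if two blocks `T₁, T₂` decompose pointwise into fine blocks `X v, Y v` (`v ∈ I`) plus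
  remainders `R₁, R₂`, and every fine pair has two-copy defect `≤ e` under a coupling `π` of `μ` with `μ`, then the
  pair `(T₁, T₂)` has defect `≤ 3 (#I² e + a₁² ∫R₁² + a₂² ∫R₂²)` (Cauchy–Schwarz over `I`, `(x+y+z)² ≤ 3(x²+y²+z²)`);
* `defect_renormalise`: passing from arbitrary positive normalisers `a₁, a₂` to the self-normalisers `ν₁, ν₂` of two
  reference blocks costs the defect of the reference pair (reverse triangle inequality in `L²(π)`);
* `tiltedTransfer_latticeBound` (registered sub-goal): for a critical Gibbs measure and the decomposition of tilted
  cells into fine axis cells of `TiltGeometry` (8), the self-normalised tilted pair `(tiltCell (3b) m u, tiltCell b m u)`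
  has defect bounded by an explicit expression in the block variances `V = blockCov · 0`, the tilted pair sums
  `W(n) = Σ_{x,y ∈ tiltCell n m 0} ⟨σ₀σ_{y−x}⟩`, the ball sums `S(R) = Σ_{z ∈ box 3 R} ⟨σ₀σ_z⟩` and the fine-pair defect `e`.

No named facts, no definitions.
-/

noncomputable section

namespace Summit.CriticalPhenomena.Ising3DConformalLimit.Cruxes.RotationJoining.RateSplitting

open MeasureTheory Literature.Probability.LatticeModels
open Summit.CriticalPhenomena.Ising3DConformalLimit.Cruxes.ExistsScaleCovariantLimit.MonotoneBlockingPort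

/-! ### The defect of a decomposed pair of blocks -/

/-- **Defect of a decomposed pair.** If `Σ_{T₁} σ = Σ_{v∈I} Σ_{X v} σ + Σ_{R₁} σ` and
`Σ_{T₂} σ = Σ_{v∈I} Σ_{Y v} σ + Σ_{R₂} σ` pointwise, and under the coupling `π` of `μ` with `μ` every fine pair
`(X v, Y v)` has defect `∫ (a₁ Σ_{X v} σ(q.1) − a₂ Σ_{Y v} σ(q.2))² dπ ≤ e`, then
`∫ (a₁ Σ_{T₁}(q.1) − a₂ Σ_{T₂}(q.2))² dπ ≤ 3 (#I² e + a₁² ∫(Σ_{R₁})² dμ + a₂² ∫(Σ_{R₂})² dμ)`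
(pointwise Cauchy–Schwarz over `I` and `(x+y+z)² ≤ 3(x²+y²+z²)`). -/
theorem defect_of_decomposition {μ : Measure (SpinConfig (Site 3))} [IsProbabilityMeasure μ]
    {π : Measure (SpinConfig (Site 3) × SpinConfig (Site 3))} (h1 : π.fst = μ) (h2 : π.snd = μ)
    (I : Finset (Fin 3 → ℤ)) (X Y : (Fin 3 → ℤ) → Finset (Site 3)) {T₁ T₂ R₁ R₂ : Finset (Site 3)}
    (hT₁ : ∀ σ, blockSum T₁ σ = ∑ v ∈ I, blockSum (X v) σ + blockSum R₁ σ)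
    (hT₂ : ∀ σ, blockSum T₂ σ = ∑ v ∈ I, blockSum (Y v) σ + blockSum R₂ σ) (a₁ a₂ : ℝ) {e : ℝ}
    (he : ∀ v ∈ I, ∫ q, (a₁ * blockSum (X v) q.1 - a₂ * blockSum (Y v) q.2) ^ 2 ∂π ≤ e) :
    ∫ q, (a₁ * blockSum T₁ q.1 - a₂ * blockSum T₂ q.2) ^ 2 ∂π ≤
      3 * ((I.card : ℝ) ^ 2 * e + a₁ ^ 2 * ∫ σ, (blockSum R₁ σ) ^ 2 ∂μ +
        a₂ ^ 2 * ∫ σ, (blockSum R₂ σ) ^ 2 ∂μ) := by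
  haveI : IsProbabilityMeasure π := isProbabilityMeasure_of_fst_eq h1
  have hpt : ∀ q : SpinConfig (Site 3) × SpinConfig (Site 3),
      a₁ * blockSum T₁ q.1 - a₂ * blockSum T₂ q.2 =
        (∑ v ∈ I, (a₁ * blockSum (X v) q.1 - a₂ * blockSum (Y v) q.2)) + a₁ * blockSum R₁ q.1 +
          (-a₂) * blockSum R₂ q.2 := by
    intro q
    rw [hT₁, hT₂, Finset.sum_sub_distrib, ← Finset.mul_sum, ← Finset.mul_sum]
    ring
  have hI : ∫ q, (a₁ * blockSum T₁ q.1 - a₂ * blockSum T₂ q.2) ^ 2 ∂π =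
      ∫ q, ((∑ v ∈ I, (a₁ * blockSum (X v) q.1 - a₂ * blockSum (Y v) q.2)) + a₁ * blockSum R₁ q.1 +
          (-a₂) * blockSum R₂ q.2) ^ 2 ∂π := by
    congr 1
    funext q
    rw [hpt]
  have hgm : ∀ v, Measurable fun q : SpinConfig (Site 3) × SpinConfig (Site 3) =>
      a₁ * blockSum (X v) q.1 - a₂ * blockSum (Y v) q.2 :=
    fun v => measurable_mul_fst_sub_mul_snd (measurable_blockSum _) (measurable_blockSum _) a₁ a₂
  have hgb : ∀ v, ∃ B, ∀ q : SpinConfig (Site 3) × SpinConfig (Site 3),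
      |a₁ * blockSum (X v) q.1 - a₂ * blockSum (Y v) q.2| ≤ B :=
    fun v => bounded_mul_fst_sub_mul_snd (bounded_blockSum _) (bounded_blockSum _) a₁ a₂
  have hm1 : Measurable fun q : SpinConfig (Site 3) × SpinConfig (Site 3) => a₁ * blockSum R₁ q.1 :=
    (measurable_const_mul_blockSum a₁ R₁).comp measurable_fst
  have hm2 : Measurable fun q : SpinConfig (Site 3) × SpinConfig (Site 3) => (-a₂) * blockSum R₂ q.2 :=
    (measurable_const_mul_blockSum (-a₂) R₂).comp measurable_snd
  have hb1 : ∃ B, ∀ q : SpinConfig (Site 3) × SpinConfig (Site 3), |a₁ * blockSum R₁ q.1| ≤ B := by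
    obtain ⟨B, hB⟩ := bounded_const_mul_blockSum a₁ R₁
    exact ⟨B, fun q => hB q.1⟩
  have hb2 : ∃ B, ∀ q : SpinConfig (Site 3) × SpinConfig (Site 3), |(-a₂) * blockSum R₂ q.2| ≤ B := by
    obtain ⟨B, hB⟩ := bounded_const_mul_blockSum (-a₂) R₂
    exact ⟨B, fun q => hB q.2⟩
  have step := integral_add_add_sq_le π (Finset.measurable_sum I fun v _ => hgm v) hm1 hm2
    (bounded_finset_sum I hgb) hb1 hb2
  have t1 : ∫ q, (∑ v ∈ I, (a₁ * blockSum (X v) q.1 - a₂ * blockSum (Y v) q.2)) ^ 2 ∂π ≤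
      (I.card : ℝ) ^ 2 * e :=
    calc ∫ q, (∑ v ∈ I, (a₁ * blockSum (X v) q.1 - a₂ * blockSum (Y v) q.2)) ^ 2 ∂π
        ≤ I.card * ∑ v ∈ I, ∫ q, (a₁ * blockSum (X v) q.1 - a₂ * blockSum (Y v) q.2) ^ 2 ∂π :=
          integral_sum_sq_le π I hgm hgb
      _ ≤ I.card * ∑ v ∈ I, e := by
          gcongr with v hv
          exact he v hv
      _ = (I.card : ℝ) ^ 2 * e := by
          rw [Finset.sum_const, nsmul_eq_mul]
          ring
  have t2 : ∫ q, (a₁ * blockSum R₁ q.1) ^ 2 ∂π = a₁ ^ 2 * ∫ σ, (blockSum R₁ σ) ^ 2 ∂μ := by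
    rw [integral_const_mul_sq, integral_sq_comp_fst h1 (measurable_blockSum R₁)]
  have t3 : ∫ q, ((-a₂) * blockSum R₂ q.2) ^ 2 ∂π = a₂ ^ 2 * ∫ σ, (blockSum R₂ σ) ^ 2 ∂μ := by
    rw [integral_const_mul_sq, integral_sq_comp_snd h2 (measurable_blockSum R₂), neg_sq]
  rw [t2, t3] at step
  rw [hI]
  linarith

/-! ### Renormalisation: from the fine (axis) normalisers to the coarse (tilted) ones -/

/-- **Renormalisation lemma.** Let `ν₁ = (√∫(Σ_{Z₁})² dμ)⁻¹`, `ν₂ = (√∫(Σ_{Z₂})² dμ)⁻¹` be the self-normalisers of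
two reference blocks `Z₁, Z₂` (positive second moments), `a₁ > 0`, `a₂ ≥ 0`. Then for any blocks `T₁, T₂` and any
coupling `π` of `μ` with `μ`,
`∫ (ν₁Σ_{T₁}(q.1) − ν₂Σ_{T₂}(q.2))² dπ ≤ 2 (ν₁/a₁)² (D(T₁,T₂) + ν₂² ∫(Σ_{T₂})² dμ · D(Z₁,Z₂))`,
`D(P,P') := ∫ (a₁Σ_P(q.1) − a₂Σ_{P'}(q.2))² dπ`: write `ν₁T₁ − ν₂T₂ = (ν₁/a₁)(a₁T₁ − a₂T₂) + (ν₁a₂/a₁ − ν₂) T₂` and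
bound `|ν₁a₂/a₁ − ν₂| = (ν₁ν₂/a₁) |a₂/ν₂ − a₁/ν₁|` by the reverse triangle inequality in `L²(π)` applied to
`a₁Σ_{Z₁}∘fst` and `a₂Σ_{Z₂}∘snd`, whose norms are `a₁/ν₁` and `a₂/ν₂`. -/
theorem defect_renormalise {μ : Measure (SpinConfig (Site 3))} [IsProbabilityMeasure μ]
    {π : Measure (SpinConfig (Site 3) × SpinConfig (Site 3))} (h1 : π.fst = μ) (h2 : π.snd = μ)
    (T₁ T₂ Z₁ Z₂ : Finset (Site 3)) {a₁ a₂ ν₁ ν₂ : ℝ} (ha₁ : 0 < a₁) (ha₂ : 0 ≤ a₂)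
    (hZ₁ : 0 < ∫ σ, (blockSum Z₁ σ) ^ 2 ∂μ) (hZ₂ : 0 < ∫ σ, (blockSum Z₂ σ) ^ 2 ∂μ)
    (hν₁ : ν₁ = (Real.sqrt (∫ σ, (blockSum Z₁ σ) ^ 2 ∂μ))⁻¹)
    (hν₂ : ν₂ = (Real.sqrt (∫ σ, (blockSum Z₂ σ) ^ 2 ∂μ))⁻¹) :
    ∫ q, (ν₁ * blockSum T₁ q.1 - ν₂ * blockSum T₂ q.2) ^ 2 ∂π ≤
      2 * (ν₁ / a₁) ^ 2 * (∫ q, (a₁ * blockSum T₁ q.1 - a₂ * blockSum T₂ q.2) ^ 2 ∂π +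
        ν₂ ^ 2 * (∫ σ, (blockSum T₂ σ) ^ 2 ∂μ) *
          ∫ q, (a₁ * blockSum Z₁ q.1 - a₂ * blockSum Z₂ q.2) ^ 2 ∂π) := by
  haveI : IsProbabilityMeasure π := isProbabilityMeasure_of_fst_eq h1
  set s₁ := Real.sqrt (∫ σ, (blockSum Z₁ σ) ^ 2 ∂μ) with hs₁
  set s₂ := Real.sqrt (∫ σ, (blockSum Z₂ σ) ^ 2 ∂μ) with hs₂
  have hs₁pos : 0 < s₁ := Real.sqrt_pos.2 hZ₁
  have hs₂pos : 0 < s₂ := Real.sqrt_pos.2 hZ₂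
  have hν₁s : ν₁ * s₁ = 1 := by rw [hν₁, inv_mul_cancel₀ hs₁pos.ne']
  have hν₂s : ν₂ * s₂ = 1 := by rw [hν₂, inv_mul_cancel₀ hs₂pos.ne']
  have ha₁ne : a₁ ≠ 0 := ha₁.ne'
  set κ := ν₁ * a₂ / a₁ - ν₂ with hκ
  -- pointwise identity and the two-term bound
  have hpt : ∀ q : SpinConfig (Site 3) × SpinConfig (Site 3),
      ν₁ * blockSum T₁ q.1 - ν₂ * blockSum T₂ q.2 =
        (ν₁ / a₁) * (a₁ * blockSum T₁ q.1 - a₂ * blockSum T₂ q.2) + κ * blockSum T₂ q.2 := by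
    intro q
    rw [hκ]
    field_simp
    ring
  have hI : ∫ q, (ν₁ * blockSum T₁ q.1 - ν₂ * blockSum T₂ q.2) ^ 2 ∂π =
      ∫ q, ((ν₁ / a₁) * (a₁ * blockSum T₁ q.1 - a₂ * blockSum T₂ q.2) + κ * blockSum T₂ q.2) ^ 2 ∂π := by
    congr 1
    funext q
    rw [hpt]
  have hHm : Measurable fun q : SpinConfig (Site 3) × SpinConfig (Site 3) =>
      (ν₁ / a₁) * (a₁ * blockSum T₁ q.1 - a₂ * blockSum T₂ q.2) :=
    (measurable_mul_fst_sub_mul_snd (measurable_blockSum _) (measurable_blockSum _) a₁ a₂).const_mul _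
  have hHb : ∃ B, ∀ q : SpinConfig (Site 3) × SpinConfig (Site 3),
      |(ν₁ / a₁) * (a₁ * blockSum T₁ q.1 - a₂ * blockSum T₂ q.2)| ≤ B := by
    obtain ⟨B, hB⟩ := bounded_mul_fst_sub_mul_snd (bounded_blockSum T₁) (bounded_blockSum T₂) a₁ a₂
    exact ⟨|ν₁ / a₁| * B, fun q => by rw [abs_mul]; gcongr; exact hB q⟩
  have hKm : Measurable fun q : SpinConfig (Site 3) × SpinConfig (Site 3) => κ * blockSum T₂ q.2 :=
    (measurable_const_mul_blockSum κ T₂).comp measurable_snd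
  have hKb : ∃ B, ∀ q : SpinConfig (Site 3) × SpinConfig (Site 3), |κ * blockSum T₂ q.2| ≤ B := by
    obtain ⟨B, hB⟩ := bounded_const_mul_blockSum κ T₂
    exact ⟨B, fun q => hB q.2⟩
  have step := integral_add_sq_le π hHm hKm hHb hKb
  rw [integral_const_mul_sq, integral_const_mul_sq, integral_sq_comp_snd h2 (measurable_blockSum T₂)] at step
  -- the normaliser mismatch `κ`
  have hκeq : κ = (ν₁ * ν₂ / a₁) * (a₂ * s₂ - a₁ * s₁) := by
    have e : (ν₁ * ν₂ / a₁) * (a₂ * s₂ - a₁ * s₁) =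
        ν₁ * a₂ / a₁ * (ν₂ * s₂) - ν₂ * (ν₁ * s₁) * (a₁ / a₁) := by ring
    rw [e, hν₁s, hν₂s, div_self ha₁ne, mul_one, mul_one, mul_one]
  obtain ⟨B₁, hB₁⟩ := bounded_const_mul_blockSum a₁ Z₁
  obtain ⟨B₂, hB₂⟩ := bounded_const_mul_blockSum a₂ Z₂
  have hrev : (a₂ * s₂ - a₁ * s₁) ^ 2 ≤ ∫ q, (a₁ * blockSum Z₁ q.1 - a₂ * blockSum Z₂ q.2) ^ 2 ∂π := by
    have e1 : Real.sqrt (∫ q, (a₁ * blockSum Z₁ q.1) ^ 2 ∂π) = a₁ * s₁ := by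
      rw [integral_const_mul_sq, integral_sq_comp_fst h1 (measurable_blockSum Z₁),
        Real.sqrt_mul' _ (integral_nonneg fun _ => sq_nonneg _), Real.sqrt_sq ha₁.le]
    have e2 : Real.sqrt (∫ q, (a₂ * blockSum Z₂ q.2) ^ 2 ∂π) = a₂ * s₂ := by
      rw [integral_const_mul_sq, integral_sq_comp_snd h2 (measurable_blockSum Z₂),
        Real.sqrt_mul' _ (integral_nonneg fun _ => sq_nonneg _), Real.sqrt_sq ha₂]
    have key := sq_sqrt_integral_sq_sub_le π (f := fun q => a₁ * blockSum Z₁ q.1) (g := fun q => a₂ * blockSum Z₂ q.2)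
      ((measurable_const_mul_blockSum a₁ Z₁).comp measurable_fst)
      ((measurable_const_mul_blockSum a₂ Z₂).comp measurable_snd) ⟨B₁, fun q => hB₁ q.1⟩ ⟨B₂, fun q => hB₂ q.2⟩
    rw [e1, e2] at key
    calc (a₂ * s₂ - a₁ * s₁) ^ 2 = (a₁ * s₁ - a₂ * s₂) ^ 2 := by ring
      _ ≤ _ := key
  have hκsq : κ ^ 2 ≤ (ν₁ * ν₂ / a₁) ^ 2 * ∫ q, (a₁ * blockSum Z₁ q.1 - a₂ * blockSum Z₂ q.2) ^ 2 ∂π := by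
    rw [hκeq, mul_pow]
    exact mul_le_mul_of_nonneg_left hrev (sq_nonneg _)
  have hT₂nn : 0 ≤ ∫ σ, (blockSum T₂ σ) ^ 2 ∂μ := integral_nonneg fun _ => sq_nonneg _
  rw [hI]
  calc _ ≤ 2 * ((ν₁ / a₁) ^ 2 * ∫ q, (a₁ * blockSum T₁ q.1 - a₂ * blockSum T₂ q.2) ^ 2 ∂π +
        κ ^ 2 * ∫ σ, (blockSum T₂ σ) ^ 2 ∂μ) := step
    _ ≤ 2 * ((ν₁ / a₁) ^ 2 * ∫ q, (a₁ * blockSum T₁ q.1 - a₂ * blockSum T₂ q.2) ^ 2 ∂π +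
        ((ν₁ * ν₂ / a₁) ^ 2 * ∫ q, (a₁ * blockSum Z₁ q.1 - a₂ * blockSum Z₂ q.2) ^ 2 ∂π) *
          ∫ σ, (blockSum T₂ σ) ^ 2 ∂μ) := by gcongr
    _ = _ := by ring

/-! ### The lattice form of the tilted defect bound -/

/-- Arithmetic: `V⁻¹ P ≤ c S / V` from `P ≤ r S`, `r ≤ c`, `S ≥ 0`, `V > 0`. -/
private theorem inv_mul_le_div {V P r c S : ℝ} (hV : 0 < V) (hP : P ≤ r * S) (hr : r ≤ c) (hS : 0 ≤ S) :
    V⁻¹ * P ≤ c * S / V := by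
  rw [div_eq_inv_mul]
  exact mul_le_mul_of_nonneg_left (hP.trans (mul_le_mul_of_nonneg_right hr hS)) (inv_nonneg.2 hV.le)

/-- Arithmetic: `J² e ≤ (b/b')⁶ e` from `J b'³ ≤ b³`. -/
private theorem card_sq_mul_le {J b b' e : ℝ} (hb' : 0 < b') (he : 0 ≤ e) (hJ0 : 0 ≤ J) (hJ : J * b' ^ 3 ≤ b ^ 3) :
    J ^ 2 * e ≤ (b / b') ^ 6 * e := by
  have hJ' : J ≤ (b / b') ^ 3 := by
    rw [div_pow, le_div_iff₀ (by positivity)]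
    exact hJ
  have hJ2 : J ^ 2 ≤ (b / b') ^ 6 :=
    calc J ^ 2 ≤ ((b / b') ^ 3) ^ 2 := pow_le_pow_left₀ hJ0 hJ' 2
      _ = (b / b') ^ 6 := by ring
  exact mul_le_mul_of_nonneg_right hJ2 he

/-- Arithmetic assembly of the final bound. -/
private theorem assemble_bound {F Du D₀ T X₁ c₂ c₃ S₆ S₂ r ν V₁ V₂ W₁ W₂ B : ℝ}
    (hF : F ≤ 2 * r * (Du + ν ^ 2 * T * D₀)) (hDu : Du ≤ 3 * (X₁ + c₂ * S₆ / V₁ + c₃ * S₂ / V₂))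
    (hD₀ : D₀ ≤ 3 * (X₁ + c₂ * S₆ / V₁ + c₃ * S₂ / V₂)) (hT : T ≤ B * S₂) (hr : r = V₁ / W₁)
    (hν : ν ^ 2 = W₂⁻¹) (hD₀nn : 0 ≤ D₀) (hrnn : 0 ≤ r) (hW₂ : 0 < W₂) (hV₁ : 0 < V₁) (hW₁ : 0 < W₁)
    (hV₂ : 0 < V₂) (hB : 0 ≤ B) (hS : 0 ≤ S₂) :
    F ≤ 6 * (V₁ / W₁ * X₁ + c₂ * (S₆ / W₁) + c₃ * (S₂ * V₁ / (V₂ * W₁))) * (1 + B * S₂ / W₂) := by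
  have hZ : 0 ≤ X₁ + c₂ * S₆ / V₁ + c₃ * S₂ / V₂ := by linarith
  have key : r * (X₁ + c₂ * S₆ / V₁ + c₃ * S₂ / V₂) =
      V₁ / W₁ * X₁ + c₂ * (S₆ / W₁) + c₃ * (S₂ * V₁ / (V₂ * W₁)) := by
    rw [hr]
    field_simp
  calc F ≤ 2 * r * (Du + ν ^ 2 * T * D₀) := hF
    _ ≤ 2 * r * (3 * (X₁ + c₂ * S₆ / V₁ + c₃ * S₂ / V₂) +
          W₂⁻¹ * (B * S₂) * (3 * (X₁ + c₂ * S₆ / V₁ + c₃ * S₂ / V₂))) := by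
        rw [hν]
        gcongr
    _ = 6 * (r * (X₁ + c₂ * S₆ / V₁ + c₃ * S₂ / V₂)) * (1 + B * S₂ / W₂) := by ring
    _ = _ := by rw [key]

/-- **Defect of a decomposed tilted pair, lattice form.** For an index set `J` of fine axis cells inside the tilted
pair at `w` (as provided by `TiltGeometry` (8)) whose fine pairs have self-normalised defect `≤ e` under `π`,
`∫ (α₁ Σ_{tilt(3b,w)}(q.1) − α₂ Σ_{tilt(b,w)}(q.2))² dπ ≤ 3 ((b/b')⁶ e + 810 b²b' S(6b)/V(3b') + 30 b²b' S(2b)/V(b'))`,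
`αᵢ` the axis normalisers at the fine scales. -/
theorem decomposed_defect_le {μ : Measure (SpinConfig (Site 3))} [IsProbabilityMeasure μ]
    (hc : ∀ A : Finset (Site 3), spinCorr μ A = plusCorr 3 (criticalBeta 3) 0 A) (hTG : TiltGeometry)
    {π : Measure (SpinConfig (Site 3) × SpinConfig (Site 3))} (h1 : π.fst = μ) (h2 : π.snd = μ)
    {b b' m : ℕ} (hb' : 1 ≤ b') (w : Fin 3 → ℤ) (J : Finset (Fin 3 → ℤ)) {e : ℝ} (he0 : 0 ≤ e)
    (hJb : ∀ v ∈ J, axisCell b' v ⊆ tiltCell b m w) (hJ3 : ∀ v ∈ J, axisCell (3 * b') v ⊆ tiltCell (3 * b) m w)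
    (hc₂ : (tiltCell b m w \ J.biUnion (axisCell b')).card ≤ 30 * b ^ 2 * b')
    (hc₁ : (tiltCell (3 * b) m w \ J.biUnion (axisCell (3 * b'))).card ≤ 810 * b ^ 2 * b')
    (hJcard : (J.card : ℝ) * (b' : ℝ) ^ 3 ≤ (b : ℝ) ^ 3)
    (he : ∀ v ∈ J, ∫ q, (normAxis μ (3 * b') * blockSum (axisCell (3 * b') v) q.1 -
        normAxis μ b' * blockSum (axisCell b' v) q.2) ^ 2 ∂π ≤ e) :
    ∫ q, (normAxis μ (3 * b') * blockSum (tiltCell (3 * b) m w) q.1 -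
        normAxis μ b' * blockSum (tiltCell b m w) q.2) ^ 2 ∂π ≤
      3 * (((b : ℝ) / b') ^ 6 * e +
          810 * (b : ℝ) ^ 2 * b' * (∑ z ∈ box 3 (2 * (3 * b)), criticalTwoPoint 3 z) / blockCov (3 * b') 0 +
          30 * (b : ℝ) ^ 2 * b' * (∑ z ∈ box 3 (2 * b), criticalTwoPoint 3 z) / blockCov b' 0) := by
  have hV₁pos : 0 < blockCov (3 * b') 0 := blockCov_zero_pos _ (by omega)
  have hV₂pos : 0 < blockCov b' 0 := blockCov_zero_pos _ hb'
  have h3b' : 1 ≤ 3 * b' := by omega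
  have hdec := defect_of_decomposition h1 h2 J (axisCell (3 * b')) (axisCell b')
      (blockSum_eq_sum_add_sdiff hTG h3b' hJ3) (blockSum_eq_sum_add_sdiff hTG hb' hJb)
      (normAxis μ (3 * b')) (normAxis μ b') he
  have t1 : (J.card : ℝ) ^ 2 * e ≤ ((b : ℝ) / b') ^ 6 * e :=
    card_sq_mul_le (by exact_mod_cast hb') he0 (Nat.cast_nonneg _) hJcard
  have hS₆ : 0 ≤ ∑ z ∈ box 3 (2 * (3 * b)), criticalTwoPoint 3 z :=
    Finset.sum_nonneg fun _ _ => criticalTwoPoint_nonneg' _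
  have hS₂ : 0 ≤ ∑ z ∈ box 3 (2 * b), criticalTwoPoint 3 z :=
    Finset.sum_nonneg fun _ _ => criticalTwoPoint_nonneg' _
  have hps₁ : ∫ σ, (blockSum (tiltCell (3 * b) m w \ J.biUnion (axisCell (3 * b'))) σ) ^ 2 ∂μ ≤
      (tiltCell (3 * b) m w \ J.biUnion (axisCell (3 * b'))).card *
        ∑ z ∈ box 3 (2 * (3 * b)), criticalTwoPoint 3 z := by
    rw [integral_blockSum_sq hc]
    exact pairSum_le_of_subset_tiltCell hTG Finset.sdiff_subset
  have hps₂ : ∫ σ, (blockSum (tiltCell b m w \ J.biUnion (axisCell b')) σ) ^ 2 ∂μ ≤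
      (tiltCell b m w \ J.biUnion (axisCell b')).card * ∑ z ∈ box 3 (2 * b), criticalTwoPoint 3 z := by
    rw [integral_blockSum_sq hc]
    exact pairSum_le_of_subset_tiltCell hTG Finset.sdiff_subset
  have t2 : (normAxis μ (3 * b')) ^ 2 *
      ∫ σ, (blockSum (tiltCell (3 * b) m w \ J.biUnion (axisCell (3 * b'))) σ) ^ 2 ∂μ ≤
        810 * (b : ℝ) ^ 2 * b' * (∑ z ∈ box 3 (2 * (3 * b)), criticalTwoPoint 3 z) / blockCov (3 * b') 0 := by
    rw [normAxis_eq hc, inv_pow, Real.sq_sqrt hV₁pos.le]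
    exact inv_mul_le_div hV₁pos hps₁ (by exact_mod_cast hc₁) hS₆
  have t3 : (normAxis μ b') ^ 2 * ∫ σ, (blockSum (tiltCell b m w \ J.biUnion (axisCell b')) σ) ^ 2 ∂μ ≤
      30 * (b : ℝ) ^ 2 * b' * (∑ z ∈ box 3 (2 * b), criticalTwoPoint 3 z) / blockCov b' 0 := by
    rw [normAxis_eq hc, inv_pow, Real.sq_sqrt hV₂pos.le]
    exact inv_mul_le_div hV₂pos hps₂ (by exact_mod_cast hc₂) hS₂
  exact hdec.trans (mul_le_mul_of_nonneg_left (add_le_add (add_le_add t1 t2) t3) (by norm_num))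

/-- **Registered sub-goal `tiltedTransfer_latticeBound`** (tool of `stub_tiltedTransfer`). Under a coupling `π` of a
critical Gibbs measure `μ` with itself whose fine axis pairs `(axisCell (3b') v, axisCell b' v)`, `|vᵢ| ≤ 2b(m+1)`,
have self-normalised defect `≤ e`, the self-normalised tilted pair `(tiltCell (3b) m u, tiltCell b m u)`, `|uᵢ| ≤ m`,
has defect at most `6 · ((V(3b')/W(3b)) (b/b')⁶ e + 810 b²b' S(6b)/W(3b) + 30 b²b' S(2b)V(3b')/(V(b')W(3b))) · (1 + b³ S(2b)/W(b))`,
where `V(n) = blockCov n 0`, `W(n) = Σ_{x,y ∈ tiltCell n m 0} ⟨σ₀σ_{y−x}⟩`, `S(R) = Σ_{z ∈ box 3 R} ⟨σ₀σ_z⟩`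
(decomposition of the tilted cells into fine axis cells plus remainders, `defect_of_decomposition`,
`defect_renormalise`, and the pair-sum bounds of the remainders). -/
theorem tiltedTransfer_latticeBound :
    ∀ μ ∈ isingGibbsMeasures 3 (criticalBeta 3) 0, TiltGeometry →
    ∀ (π : Measure (SpinConfig (Site 3) × SpinConfig (Site 3))), π.fst = μ → π.snd = μ →
    ∀ (b b' m : ℕ) (u : Fin 3 → ℤ) (e : ℝ), 1 ≤ b' → 3 * b' ≤ b → (∀ i, |u i| ≤ m) → 0 ≤ e →
    (∀ v : Fin 3 → ℤ, (∀ i, |v i| ≤ 2 * (b : ℤ) * ((m : ℤ) + 1)) →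
      ∫ q, (normAxis μ (3 * b') * blockSum (axisCell (3 * b') v) q.1 -
        normAxis μ b' * blockSum (axisCell b' v) q.2) ^ 2 ∂π ≤ e) →
    ∫ q, (normTilt μ (3 * b) m * blockSum (tiltCell (3 * b) m u) q.1 -
        normTilt μ b m * blockSum (tiltCell b m u) q.2) ^ 2 ∂π ≤
      6 * (blockCov (3 * b') 0 / (∑ x ∈ tiltCell (3 * b) m 0, ∑ y ∈ tiltCell (3 * b) m 0, criticalTwoPoint 3 (y - x)) *
            (((b : ℝ) / b') ^ 6 * e) +
          810 * (b : ℝ) ^ 2 * b' * ((∑ z ∈ box 3 (2 * (3 * b)), criticalTwoPoint 3 z) /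
            ∑ x ∈ tiltCell (3 * b) m 0, ∑ y ∈ tiltCell (3 * b) m 0, criticalTwoPoint 3 (y - x)) +
          30 * (b : ℝ) ^ 2 * b' * ((∑ z ∈ box 3 (2 * b), criticalTwoPoint 3 z) * blockCov (3 * b') 0 /
            (blockCov b' 0 * ∑ x ∈ tiltCell (3 * b) m 0, ∑ y ∈ tiltCell (3 * b) m 0, criticalTwoPoint 3 (y - x)))) *
        (1 + (b : ℝ) ^ 3 * (∑ z ∈ box 3 (2 * b), criticalTwoPoint 3 z) /
          ∑ x ∈ tiltCell b m 0, ∑ y ∈ tiltCell b m 0, criticalTwoPoint 3 (y - x)) := by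
  intro μ hμ hTG π h1 h2 b b' m u e hb' h3b hu he0 he
  obtain ⟨hP, hc⟩ := criticalState_of_mem' hμ
  have h5 := hTG.2.2.2.2.1
  have h8 := hTG.2.2.2.2.2.2.2.1
  have h0m : ∀ i, |(0 : Fin 3 → ℤ) i| ≤ (m : ℤ) := fun i => by simp
  obtain ⟨I, hIw, hIb, hI3, hR₂c, hR₁c, hIcard⟩ := h8 b b' m u hb' h3b hu
  obtain ⟨I₀, hIw₀, hIb₀, hI3₀, hR₂c₀, hR₁c₀, hIcard₀⟩ := h8 b b' m 0 hb' h3b h0m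
  have hDu := decomposed_defect_le hc hTG h1 h2 hb' u I he0 hIb hI3 hR₂c hR₁c hIcard
    fun v hv => he v (hIw v hv)
  have hD₀ := decomposed_defect_le hc hTG h1 h2 hb' 0 I₀ he0 hIb₀ hI3₀ hR₂c₀ hR₁c₀ hIcard₀
    fun v hv => he v (hIw₀ v hv)
  -- positivity of the variances and normalisers
  have hV₁pos : 0 < blockCov (3 * b') 0 := blockCov_zero_pos _ (by omega)
  have hV₂pos : 0 < blockCov b' 0 := blockCov_zero_pos _ hb'
  have hW₁pos : 0 < ∑ x ∈ tiltCell (3 * b) m 0, ∑ y ∈ tiltCell (3 * b) m 0, criticalTwoPoint 3 (y - x) :=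
    pairSum_tiltCell_pos hTG (by omega) m
  have hW₂pos : 0 < ∑ x ∈ tiltCell b m 0, ∑ y ∈ tiltCell b m 0, criticalTwoPoint 3 (y - x) :=
    pairSum_tiltCell_pos hTG (by omega) m
  have hT₁int := integral_blockSum_sq hc (tiltCell (3 * b) m 0)
  have hT₂int := integral_blockSum_sq hc (tiltCell b m 0)
  have ha₁pos : 0 < normAxis μ (3 * b') := by
    rw [normAxis_eq hc]
    exact inv_pos.2 (Real.sqrt_pos.2 hV₁pos)
  have ha₂pos : 0 < normAxis μ b' := by
    rw [normAxis_eq hc]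
    exact inv_pos.2 (Real.sqrt_pos.2 hV₂pos)
  have hren := defect_renormalise h1 h2 (tiltCell (3 * b) m u) (tiltCell b m u) (tiltCell (3 * b) m 0)
    (tiltCell b m 0) (ν₁ := normTilt μ (3 * b) m) (ν₂ := normTilt μ b m) ha₁pos ha₂pos.le
    (by rw [hT₁int]; exact hW₁pos) (by rw [hT₂int]; exact hW₂pos) rfl rfl
  -- the coarse block at `u`
  have hS₂ : 0 ≤ ∑ z ∈ box 3 (2 * b), criticalTwoPoint 3 z := Finset.sum_nonneg fun _ _ => criticalTwoPoint_nonneg' _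
  have hT₂u : ∫ σ, (blockSum (tiltCell b m u) σ) ^ 2 ∂μ ≤ (b : ℝ) ^ 3 * ∑ z ∈ box 3 (2 * b), criticalTwoPoint 3 z := by
    rw [integral_blockSum_sq hc]
    have key := pairSum_le_of_subset_tiltCell hTG (Finset.Subset.refl (tiltCell b m u))
    rw [h5 b m u hu] at key
    push_cast at key
    exact key
  -- scalar identities and assembly
  have hratio : (normTilt μ (3 * b) m / normAxis μ (3 * b')) ^ 2 =
      blockCov (3 * b') 0 / ∑ x ∈ tiltCell (3 * b) m 0, ∑ y ∈ tiltCell (3 * b) m 0, criticalTwoPoint 3 (y - x) := by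
    rw [div_pow, normAxis_eq hc, normTilt, hT₁int, inv_pow, inv_pow, Real.sq_sqrt hV₁pos.le,
      Real.sq_sqrt hW₁pos.le, inv_div_inv]
  have hν₂sq : (normTilt μ b m) ^ 2 = (∑ x ∈ tiltCell b m 0, ∑ y ∈ tiltCell b m 0, criticalTwoPoint 3 (y - x))⁻¹ := by
    rw [normTilt, hT₂int, inv_pow, Real.sq_sqrt hW₂pos.le]
  exact assemble_bound hren hDu hD₀ hT₂u hratio hν₂sq (integral_nonneg fun _ => sq_nonneg _) (sq_nonneg _) hW₂pos
    hV₁pos hW₁pos hV₂pos (by positivity) hS₂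

end Summit.CriticalPhenomena.Ising3DConformalLimit.Cruxes.RotationJoining.RateSplitting

end
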